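import Literature.NumberTheory.Sieve.LinearEquationsInPrimesMainReduction
import Literature.NumberTheory.Sieve.LinearEquationsInPrimesTwinSystem
import Mathlib.Data.Fin.Tuple.Finset
import HarnessLib

/-!
# Fibration lemma (`DimOne → GeneralizedHardyLittlewood`), part 1: fibring over the last coordinate

Support file for the statement item `FibrationLemma : DimOne → GeneralizedHardyLittlewood` of the
routes of `Summits/Parity/GeneralizedHardyLittlewood` (Green–Tao 2010, §1, the remark after
Conj. 1.2: "a `d`-parameter version … would follow easily by holding `d − 1` of the variables fixed
and summing in the remaining one").

A system `Ψ = (ψ₁, …, ψ_t)` of affine-linear forms on `ℤ^{d+1}` is fibred over its first `d`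
coordinates: writing `n = (w, m)` with `w ∈ ℤ^d`, `m ∈ ℤ`,
`ψᵢ(w, m) = aᵢ m + ψᵢᵇ(w)` with `aᵢ = ψ̇ᵢ(e_{d+1})` (`lastCoeff`) and the *base form*
`ψᵢᵇ` on `ℤ^d` (`baseForm`). For fixed `w` the *fibre system* `Φ_w = (aᵢ m + ψᵢᵇ(w))ᵢ`
(`fibreSystem`) is a `d = 1` system, and the *fibre body* `K_x = {y : (x, y) ∈ K}` (`fibreBody`)
of a convex `K ⊆ [-N, N]^{d+1}` is a convex subset of `[-N, N]`.

Contents (all elementary bookkeeping, no number theory):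
* `sum_piFinset_succ_const` — `∑_{n ∈ s^{d+1}} F(n) = ∑_{w ∈ s^d} ∑_{m ∈ s} F(w, m)`;
* `vonMangoldtSum_eq_sum_fibre` — `∑_{n ∈ K ∩ ℤ^{d+1}} ∏ᵢ Λ(ψᵢ(n)) = ∑_w ∑_{m ∈ K_w ∩ ℤ} ∏ᵢ Λ(φ_{w,i}(m))`;
* `localFactor_eq_avg_fibre` — `β_q(Ψ) = 𝔼_{w ∈ (ℤ/q)^d} β_q(Φ_w)` (definition of `β_q`);
* `localFactor_fibreSystem_congr` — `β_q(Φ_w)` depends only on `w mod q`;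
* `affLinSize_fibreSystem_le` — `‖Φ_w‖_N ≤ t (d + 2) L` when the coefficients of `Ψ` are `≤ L`
  and its constants `≤ L N`, for `w ∈ [-N, N]^d`.
-/

noncomputable section

open Finset

namespace Summit.Parity.GeneralizedHardyLittlewood.Theorems

open Literature.NumberTheory.Sieve

variable {d t : ℕ}

/-! ### Splitting sums over `s^{d+1}` -/

/-- `∑_{n ∈ s^{d+1}} F(n) = ∑_{w ∈ s^d} ∑_{m ∈ s} F(snoc w m)`. [folklore] -/
theorem sum_piFinset_succ_const {α M : Type*} [AddCommMonoid M] (s : Finset α)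
    (F : (Fin (d + 1) → α) → M) :
    ∑ n ∈ Fintype.piFinset (fun _ : Fin (d + 1) => s), F n =
      ∑ w ∈ Fintype.piFinset (fun _ : Fin d => s), ∑ m ∈ s, F (Fin.snoc w m) := by
  classical
  have h := Finset.filter_piFinset_eq_map_snocEquiv (fun _ : Fin (d + 1) => s) (fun _ => True)
  rw [Finset.filter_true_of_mem (fun _ _ => trivial),
    Finset.filter_true_of_mem (fun _ _ => trivial)] at h
  rw [h, Finset.sum_map, Finset.sum_product_right]
  rfl

/-! ### Base forms, fibre coefficients, fibre systems -/

/-- The base form `ψᵇ` of `ψ` on `ℤ^{d+1}`: the affine-linear form on `ℤ^d` obtained by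
restricting to the first `d` coordinates (`ψᵇ(w) = ψ(w, 0)`). [cite: GreenTao2010, §1 (remark after Conj. 1.2)] -/
def baseForm (ψ : AffLinForm (d + 1)) : AffLinForm d :=
  ⟨fun j => ψ.coeff (Fin.castSucc j), ψ.const⟩

/-- The fibre coefficient `a = ψ̇(e_{d+1})`. [cite: GreenTao2010, §1 (remark after Conj. 1.2)] -/
def lastCoeff (ψ : AffLinForm (d + 1)) : ℤ :=
  ψ.coeff (Fin.last d)

/-- The fibre form over `w ∈ ℤ^d`: the `d = 1` form `m ↦ a m + ψᵇ(w)`.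
[cite: GreenTao2010, §1 (remark after Conj. 1.2)] -/
def fibreForm (ψ : AffLinForm (d + 1)) (w : Fin d → ℤ) : AffLinForm 1 :=
  ⟨![lastCoeff ψ], (baseForm ψ).eval w⟩

/-- The fibre system `Φ_w = (aᵢ m + ψᵢᵇ(w))ᵢ` of `Ψ` over `w ∈ ℤ^d`.
[cite: GreenTao2010, §1 (remark after Conj. 1.2)] -/
def fibreSystem (Ψ : Fin t → AffLinForm (d + 1)) (w : Fin d → ℤ) : Fin t → AffLinForm 1 :=
  fun i => fibreForm (Ψ i) w

/-- `(fibreForm ψ w).coeff 0 = lastCoeff ψ`. [folklore] -/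
@[simp] theorem fibreForm_coeff (ψ : AffLinForm (d + 1)) (w : Fin d → ℤ) (j : Fin 1) :
    (fibreForm ψ w).coeff j = lastCoeff ψ := by
  simp [fibreForm, Fin.fin_one_eq_zero j]

/-- `(fibreForm ψ w).const = ψᵇ(w)`. [folklore] -/
@[simp] theorem fibreForm_const (ψ : AffLinForm (d + 1)) (w : Fin d → ℤ) :
    (fibreForm ψ w).const = (baseForm ψ).eval w := rfl

/-- `ψ(w, m) = a m + ψᵇ(w)`. [cite: GreenTao2010, §1 (remark after Conj. 1.2)] -/
theorem eval_snoc (ψ : AffLinForm (d + 1)) (w : Fin d → ℤ) (m : ℤ) :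
    ψ.eval (Fin.snoc w m) = lastCoeff ψ * m + (baseForm ψ).eval w := by
  simp only [AffLinForm.eval, Fin.sum_univ_castSucc, Fin.snoc_castSucc, Fin.snoc_last, lastCoeff,
    baseForm]
  ring

/-- `φ_w(n) = a n₀ + ψᵇ(w)` for the fibre form. [folklore] -/
theorem fibreForm_eval (ψ : AffLinForm (d + 1)) (w : Fin d → ℤ) (n : Fin 1 → ℤ) :
    (fibreForm ψ w).eval n = lastCoeff ψ * n 0 + (baseForm ψ).eval w := by
  simp [AffLinForm.eval, fibreForm]

/-- `φ_w(n) = ψ(w, n₀)`. [cite: GreenTao2010, §1 (remark after Conj. 1.2)] -/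
theorem fibreForm_eval_eq_eval_snoc (ψ : AffLinForm (d + 1)) (w : Fin d → ℤ) (n : Fin 1 → ℤ) :
    (fibreForm ψ w).eval n = ψ.eval (Fin.snoc w (n 0)) := by
  rw [fibreForm_eval, eval_snoc]

/-- The real extension splits the same way: `ψ(x, y) = a y + ψᵇ(x)` on `ℝ^{d+1}`. [folklore] -/
theorem realEval_snoc (ψ : AffLinForm (d + 1)) (x : Fin d → ℝ) (y : ℝ) :
    ψ.realEval (Fin.snoc x y) = (lastCoeff ψ : ℝ) * y + (baseForm ψ).realEval x := by
  simp only [AffLinForm.realEval, Fin.sum_univ_castSucc, Fin.snoc_castSucc, Fin.snoc_last,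
    lastCoeff, baseForm]
  ring

/-- The real extension of the fibre form: `φ_w(y) = a y₀ + ψᵇ(w)`. [folklore] -/
theorem fibreForm_realEval (ψ : AffLinForm (d + 1)) (w : Fin d → ℤ) (y : Fin 1 → ℝ) :
    (fibreForm ψ w).realEval y = (lastCoeff ψ : ℝ) * y 0 + ((baseForm ψ).eval w : ℝ) := by
  simp [AffLinForm.realEval, fibreForm]

/-! ### Real points and fibre bodies -/

/-- `realPoint (snoc w m) = snoc (realPoint w) m`. [folklore] -/
theorem realPoint_snoc (w : Fin d → ℤ) (m : ℤ) :
    realPoint (Fin.snoc w m : Fin (d + 1) → ℤ) = Fin.snoc (realPoint w) (m : ℝ) := by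
  funext k
  refine Fin.lastCases ?_ (fun j => ?_) k
  · simp [realPoint]
  · simp [realPoint]

/-- The real extension of the base form at a lattice point. [folklore] -/
theorem baseForm_realEval_realPoint (ψ : AffLinForm (d + 1)) (w : Fin d → ℤ) :
    (baseForm ψ).realEval (realPoint w) = ((baseForm ψ).eval w : ℝ) := by
  rw [show realPoint w = fun j => (w j : ℝ) from rfl, AffLinForm.realEval_intCast]

/-- The fibre body `K_x = {y ∈ ℝ : (x, y) ∈ K}` of `K ⊆ ℝ^{d+1}` over `x ∈ ℝ^d`, as a subset
of `ℝ^1`. [cite: GreenTao2010, §1 (remark after Conj. 1.2)] -/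
def fibreBody (K : Set (Fin (d + 1) → ℝ)) (x : Fin d → ℝ) : Set (Fin 1 → ℝ) :=
  {y | (Fin.snoc x (y 0) : Fin (d + 1) → ℝ) ∈ K}

/-- Membership in the fibre body. [folklore] -/
@[simp] theorem mem_fibreBody {K : Set (Fin (d + 1) → ℝ)} {x : Fin d → ℝ} {y : Fin 1 → ℝ} :
    y ∈ fibreBody K x ↔ (Fin.snoc x (y 0) : Fin (d + 1) → ℝ) ∈ K := Iff.rfl

/-- `snoc x` is affine in the last variable: `snoc x (a y + b y') = a snoc x y + b snoc x y'` when
`a + b = 1`. [folklore] -/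
theorem snoc_convex_comb (x : Fin d → ℝ) (y y' a b : ℝ) (hab : a + b = 1) :
    (Fin.snoc x (a * y + b * y') : Fin (d + 1) → ℝ) =
      a • (Fin.snoc x y : Fin (d + 1) → ℝ) + b • (Fin.snoc x y' : Fin (d + 1) → ℝ) := by
  funext k
  refine Fin.lastCases ?_ (fun j => ?_) k
  · simp
  · simp only [Fin.snoc_castSucc, Pi.add_apply, Pi.smul_apply, smul_eq_mul]
    rw [← add_mul, hab, one_mul]

/-- Fibre bodies of convex sets are convex. [folklore] -/
theorem convex_fibreBody {K : Set (Fin (d + 1) → ℝ)} (hK : Convex ℝ K) (x : Fin d → ℝ) :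
    Convex ℝ (fibreBody K x) := by
  intro y hy y' hy' a b ha hb hab
  simp only [mem_fibreBody] at hy hy' ⊢
  have : (Fin.snoc x ((a • y + b • y') 0) : Fin (d + 1) → ℝ) =
      a • (Fin.snoc x (y 0) : Fin (d + 1) → ℝ) + b • (Fin.snoc x (y' 0) : Fin (d + 1) → ℝ) := by
    simpa using snoc_convex_comb x (y 0) (y' 0) a b hab
  rw [this]
  exact hK hy hy' ha hb hab

/-- Fibre bodies of subsets of `[-N, N]^{d+1}` lie in `[-N, N]`. [folklore] -/
theorem fibreBody_subset_realBox {K : Set (Fin (d + 1) → ℝ)} {N : ℝ} (hK : K ⊆ realBox (d + 1) N)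
    (x : Fin d → ℝ) : fibreBody K x ⊆ realBox 1 N := by
  intro y hy
  have h := hK hy
  simp only [realBox, Set.mem_Icc, Pi.le_def] at h ⊢
  refine ⟨fun j => ?_, fun j => ?_⟩
  · have := h.1 (Fin.last d)
    rw [Fin.snoc_last] at this
    rwa [Fin.fin_one_eq_zero j]
  · have := h.2 (Fin.last d)
    rw [Fin.snoc_last] at this
    rwa [Fin.fin_one_eq_zero j]

open Classical in
/-- Splitting a sum over `K ∩ ℤ^{d+1}` into fibres:
`∑_{n ∈ K ∩ ℤ^{d+1}} F(n) = ∑_{w ∈ [-N,N]^d} ∑_{m ∈ [-N,N], (w,m) ∈ K} F(w, m)`. [folklore] -/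
theorem sum_filter_latticeBox_succ {M : Type*} [AddCommMonoid M] (K : Set (Fin (d + 1) → ℝ))
    (N : ℕ) (F : (Fin (d + 1) → ℤ) → M) :
    ∑ n ∈ (latticeBox (d + 1) N).filter (fun n => realPoint n ∈ K), F n =
      ∑ w ∈ latticeBox d N, ∑ m ∈ (Icc (-(N : ℤ)) N).filter
        (fun m => realPoint (Fin.snoc w m : Fin (d + 1) → ℤ) ∈ K), F (Fin.snoc w m) := by
  rw [Finset.sum_filter]
  unfold latticeBox
  rw [sum_piFinset_succ_const]
  refine Finset.sum_congr rfl fun w _ => ?_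
  rw [Finset.sum_filter]

open Classical in
/-- **The von Mangoldt sum fibres**: `∑_{n ∈ K ∩ ℤ^{d+1}} ∏ᵢ Λ(ψᵢ(n)) = ∑_{w ∈ [-N,N]^d}
∑_{m ∈ K_w ∩ ℤ} ∏ᵢ Λ(φ_{w,i}(m))`, i.e. the weighted sum of `Ψ` over `K` is the sum over the base
points `w` of the weighted sums of the fibre systems over the fibre bodies ("holding `d − 1` of the
variables fixed and summing in the remaining one"). [cite: GreenTao2010, §1 (remark after Conj. 1.2)] -/
theorem vonMangoldtSum_eq_sum_fibre (Ψ : Fin t → AffLinForm (d + 1)) (K : Set (Fin (d + 1) → ℝ))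
    (N : ℕ) :
    vonMangoldtSum Ψ K N =
      ∑ w ∈ latticeBox d N, vonMangoldtSum (fibreSystem Ψ w) (fibreBody K (realPoint w)) N := by
  unfold vonMangoldtSum
  rw [sum_filter_latticeBox_succ]
  refine Finset.sum_congr rfl fun w _ => ?_
  -- the inner sum over `m ∈ [-N, N]` is the sum over `[-N,N]^1`
  unfold latticeBox
  symm
  rw [Finset.sum_filter, sum_piFinset_const_fin_one, ← Finset.sum_filter]
  refine Finset.sum_congr ?_ fun m _ => ?_
  · congr 1
    ext m
    simp only [mem_fibreBody, realPoint_snoc]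
    rfl
  · refine Finset.prod_congr rfl fun i _ => ?_
    rw [fibreSystem, fibreForm_eval_eq_eval_snoc]

/-! ### The local factors of a fibred system -/

/-- Casting a `snoc` of natural-number vectors to `ℤ` commutes with `snoc`. [folklore] -/
theorem intCast_snoc (w : Fin d → ℕ) (m : ℕ) :
    (fun k => ((Fin.snoc w m : Fin (d + 1) → ℕ) k : ℤ)) = Fin.snoc (fun j => (w j : ℤ)) (m : ℤ) := by
  funext k
  refine Fin.lastCases ?_ (fun j => ?_) k
  · simp
  · simp

/-- **`β_q(Ψ) = 𝔼_{w ∈ (ℤ/qℤ)^d} β_q(Φ_w)`**: the local factor of `Ψ` at any modulus `q ≥ 1` is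
the average over the base residues of the local factors of the fibre systems (immediate from the
definition (1.6) of `β_q` as an average over `(ℤ/qℤ)^{d+1}`). [cite: GreenTao2010, (1.6)] -/
theorem localFactor_eq_avg_fibre (Ψ : Fin t → AffLinForm (d + 1)) {q : ℕ} (hq : q ≠ 0) :
    localFactor Ψ q = ((q : ℝ) ^ d)⁻¹ *
      ∑ w ∈ Fintype.piFinset (fun _ : Fin d => range q),
        localFactor (fibreSystem Ψ fun j => (w j : ℤ)) q := by
  have hq' : (q : ℝ) ≠ 0 := by exact_mod_cast hq
  unfold localFactor
  rw [sum_piFinset_succ_const, Finset.mul_sum, Finset.mul_sum]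
  refine Finset.sum_congr rfl fun w _ => ?_
  rw [sum_piFinset_fin_one, ← mul_assoc]
  congr 1
  · rw [pow_succ, mul_inv, pow_one]
  · refine Finset.sum_congr rfl fun m _ => Finset.prod_congr rfl fun i _ => ?_
    rw [intCast_snoc, fibreSystem, fibreForm_eval_eq_eval_snoc]

/-- The reduction mod `q` of a fibre form depends only on `w mod q`. [folklore] -/
theorem modEval_fibreForm_congr (ψ : AffLinForm (d + 1)) {q : ℕ} {w w' : Fin d → ℤ}
    (h : ∀ j, ((w j : ℤ) : ZMod q) = w' j) (v : Fin 1 → ZMod q) :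
    (fibreForm ψ w).modEval q v = (fibreForm ψ w').modEval q v := by
  simp only [AffLinForm.modEval, fibreForm_coeff, fibreForm_const, AffLinForm.intCast_eval]
  congr 2
  simp only [h]

/-- **Periodicity**: `β_q(Φ_w)` depends only on `w mod q`. [cite: GreenTao2010, (1.6)] -/
theorem localFactor_fibreSystem_congr (Ψ : Fin t → AffLinForm (d + 1)) {q : ℕ} [NeZero q]
    {w w' : Fin d → ℤ} (h : ∀ j, ((w j : ℤ) : ZMod q) = w' j) :
    localFactor (fibreSystem Ψ w) q = localFactor (fibreSystem Ψ w') q := by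
  rw [localFactor_eq_sum_zmod, localFactor_eq_sum_zmod]
  congr 1
  refine Finset.sum_congr rfl fun v _ => Finset.prod_congr rfl fun i _ => ?_
  rw [fibreSystem, fibreSystem, modEval_fibreForm_congr (Ψ i) h v]

/-! ### Size of the fibre systems -/

/-- `|ψᵇ(w)| ≤ d L N + L N` if `|ψ̇(e_j)| ≤ L`, `|ψ(0)| ≤ L N` and `w ∈ [-N, N]^d`. [folklore] -/
theorem abs_baseForm_eval_le {ψ : AffLinForm (d + 1)} {L N : ℕ}
    (hL : ∀ j, (ψ.coeff j).natAbs ≤ L) (hc : ψ.const.natAbs ≤ L * N) {w : Fin d → ℤ}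
    (hw : w ∈ latticeBox d N) : |(baseForm ψ).eval w| ≤ (d * L * N + L * N : ℕ) := by
  have hwj : ∀ j, |w j| ≤ N := fun j => by
    have := Fintype.mem_piFinset.mp hw j
    rw [Finset.mem_Icc] at this
    exact abs_le.mpr ⟨this.1, this.2⟩
  have hLj : ∀ j : Fin d, |ψ.coeff (Fin.castSucc j)| ≤ L := fun j => by
    rw [Int.abs_eq_natAbs]; exact_mod_cast hL _
  have hcL : |ψ.const| ≤ (L * N : ℕ) := by rw [Int.abs_eq_natAbs]; exact_mod_cast hc
  simp only [AffLinForm.eval, baseForm]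
  calc |∑ j, ψ.coeff (Fin.castSucc j) * w j + ψ.const|
      ≤ |∑ j, ψ.coeff (Fin.castSucc j) * w j| + |ψ.const| := abs_add_le _ _
    _ ≤ ∑ j, |ψ.coeff (Fin.castSucc j) * w j| + |ψ.const| := by
        gcongr; exact Finset.abs_sum_le_sum_abs _ _
    _ ≤ ∑ _j : Fin d, (L : ℤ) * N + (L * N : ℕ) := by
        gcongr with j
        · rw [abs_mul]
          exact mul_le_mul (hLj j) (hwj j) (abs_nonneg _) (by positivity)
    _ = (d * L * N + L * N : ℕ) := by
        rw [Finset.sum_const, Finset.card_univ, Fintype.card_fin]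
        push_cast
        ring

/-- **Size of the fibre systems**: if `|ψ̇ᵢ(e_j)| ≤ L`, `|ψᵢ(0)| ≤ L N` and `w ∈ [-N, N]^d`
(`N ≥ 1`), then `‖Φ_w‖_N ≤ t (d + 2) L` — the uniformity in the constant terms that
Conj. 1.2 builds into `‖Ψ‖_N ≤ L`. [cite: GreenTao2010, (1.1)] -/
theorem affLinSize_fibreSystem_le {Ψ : Fin t → AffLinForm (d + 1)} {L N : ℕ} (hN : 1 ≤ N)
    (hL : ∀ i j, ((Ψ i).coeff j).natAbs ≤ L) (hc : ∀ i, (Ψ i).const.natAbs ≤ L * N)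
    {w : Fin d → ℤ} (hw : w ∈ latticeBox d N) :
    affLinSize (fibreSystem Ψ w) N ≤ ((t * (d + 2) * L : ℕ) : ℝ) := by
  have hN0 : (0 : ℝ) < N := by exact_mod_cast hN
  unfold affLinSize
  have h1 : ∀ i, ∑ j : Fin 1, |(((fibreSystem Ψ w) i).coeff j : ℝ)| ≤ L := fun i => by
    simp only [Fin.sum_univ_one, fibreSystem, fibreForm_coeff, lastCoeff]
    have := hL i (Fin.last d)
    rw [← Int.cast_abs, Int.abs_eq_natAbs]
    exact_mod_cast this
  have h2 : ∀ i, |(((fibreSystem Ψ w) i).const : ℝ) / N| ≤ (d * L + L : ℕ) := fun i => by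
    simp only [fibreSystem, fibreForm_const]
    rw [abs_div, abs_of_pos hN0, div_le_iff₀ hN0]
    have := abs_baseForm_eval_le (hL i) (hc i) hw
    have h' : |(((baseForm (Ψ i)).eval w : ℤ) : ℝ)| ≤ ((d * L * N + L * N : ℕ) : ℝ) := by
      rw [← Int.cast_abs]; exact_mod_cast this
    refine h'.trans (le_of_eq ?_)
    push_cast
    ring
  calc ∑ i, ∑ j : Fin 1, |(((fibreSystem Ψ w) i).coeff j : ℝ)| +
        ∑ i, |(((fibreSystem Ψ w) i).const : ℝ) / N|
      ≤ ∑ _i : Fin t, (L : ℝ) + ∑ _i : Fin t, ((d * L + L : ℕ) : ℝ) :=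
        add_le_add (Finset.sum_le_sum fun i _ => h1 i) (Finset.sum_le_sum fun i _ => h2 i)
    _ = ((t * (d + 2) * L : ℕ) : ℝ) := by
        rw [Finset.sum_const, Finset.sum_const, Finset.card_univ, Fintype.card_fin]
        push_cast
        ring

end Summit.Parity.GeneralizedHardyLittlewood.Theorems
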